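import Summits.Ventures.Crystal3D.Bulk.GapExtremal
import Summits.Ventures.Crystal3D.Bulk.GapReductionSharp
import Summits.Ventures.Crystal3D.Bulk.HoleForm
import Literature.Geometry.DiscreteGeometry.KissingNumberThreeProofs
import HarnessLib

/-!
# GAP by a census on a WINDOW plus a CUT above the window

HONEST FRAMING. Part of the venture `Summits/Ventures/Crystal3D` (cell `pub-crystal3d`, phase 2,
24-hour decision sprint, `TARGET-GAP.md` §4.2/§4.2′ and the lead's `DECISION-GAP` template §1A/§2.U;
seat typer-bulk). The sprint certifies the angular gap `NoHole 0.63` (= GAP(1.26), `Bulk/HoleForm.lean`)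
by an enumerate-and-kill census that does NOT cover the whole range of hole radii: it covers a
WINDOW of extremal hole radii `ρ* ∈ [φ*, ρ_top]` (tier I: `ρ_top = 51.106123°`; the MT-free stretch:
`ρ_top = 55°…60°`), and a separate CUT supplies `ρ* < ρ_top` (the range cut "mod MT", a certified
SDP top cut, or the proved kissing theorem at `60°`). This file types that decomposition and proves
the glue, in the fourteen-ball currency of `Bulk/GapCensusSkeleton.lean` / `Bulk/GapExtremal.lean`
(intruder distance `D = 2 cos ρ`; the window `ρ ∈ [arccos (hi/2), arccos (lo/2)]` is
`D ∈ [lo, hi]`) and in the angular currency of `Bulk/HoleForm.lean` (`NoHole t`, `t = cos ρ`):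

* `ExtremalFreeWindow lo hi` — no REDUCED EXTREMAL configuration (`IsReducedExtremal`: most
  intruding, fewest tight pairs — the object the structure lemmas P-L1–P-L3 and the generators are
  about) has intruder distance in the CLOSED window `[lo, hi]`. This is exactly what a census that is
  complete on the window and fully killed delivers (`GapCensus.CompleteReducedOn`,
  `GapCensus.extremalFreeWindow`), and windows compose (`ExtremalFreeWindow.union`: tier I and the
  stretch may be cleared by different machines).
* `exists_isReducedExtremal_of_not_noHole` — if (AG) fails at level `t`, a reduced extremal
  configuration intrudes within `max (2t) 1` (compactness + well-ordering, from the tree).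
* THE GLUE `noHole_of_noHole_of_extremalFreeWindow :
    1/2 ≤ t → NoHole t₁ → ExtremalFreeWindow (2t₁) (2t) → NoHole t` — a cut at level `t₁`
  (`ρ* < arccos t₁`) and a cleared window `[2t₁, 2t]` give (AG) at level `t`; fourteen-ball form
  `gapTupleDiam_of_gapTupleDiam_of_extremalFreeWindow : GapTupleDiam lo → ExtremalFreeWindow lo hi →
    GapTupleDiam hi`.
* Instances at the sprint's numbers: `noHole_063_of_noHole_of_window`,
  `noHole_063_of_noHole_of_census`, and the bulk conclusions with `K = 1296` / `K = 702` given the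
  classification at gap `2.52` (the tree's computational theorem, kept a hypothesis here so that this
  file stays on the standard axioms).

Nothing is claimed about GAP(1.26): `ExtremalFreeWindow (2t₁) 1.26` is what the two census
implementations must certify on their tier(s) and `NoHole t₁` is what the cut must supply
(`TARGET-GAP.md` §4.2: `t₁ = cos 51.106123°` modulo `musinTarasov2012_tammes_thirteen`; §4.2′/(U): a
certified top cut; at `t₁ = 1/2` the cut is the PROVED kissing theorem — see `noHole_half` below:
thirteen `60°`-separated directions do not exist). Elementary order reasoning on top of the tree.
-/

noncomputable section

open scoped BigOperators InnerProductSpace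
open Finset

namespace Summit.Ventures.Crystal3D

open Literature.Geometry.DiscreteGeometry

/-! ## Cleared windows of intruder distances -/

/-- **A cleared window** `[lo, hi]` of intruder distances: no REDUCED EXTREMAL admissible
fourteen-ball configuration (`IsReducedExtremal`: minimal intruder distance among admissible
configurations, and among those the fewest tight pairs) has its intruder distance in the closed
interval `[lo, hi]`. In hole radii: no reduced extremal pair `(X, p)` has
`ρ* ∈ [arccos (hi/2), arccos (lo/2)]`. This is the deliverable of an enumerate-and-kill census on
that window (`GapCensus.extremalFreeWindow`). -/
def ExtremalFreeWindow (lo hi : ℝ) : Prop :=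
  ∀ c, IsReducedExtremal c → lo ≤ intruderDist c → intruderDist c ≤ hi → False

/-- A cleared window stays cleared after shrinking it. -/
theorem ExtremalFreeWindow.mono {lo hi lo' hi' : ℝ} (h : ExtremalFreeWindow lo hi) (hlo : lo ≤ lo')
    (hhi : hi' ≤ hi) : ExtremalFreeWindow lo' hi' :=
  fun c hc h1 h2 => h c hc (hlo.trans h1) (h2.trans hhi)

/-- **Windows compose**: clearing `[lo, mid]` and `[mid, hi]` clears `[lo, hi]` (tier I and the
stretch above it may be cleared by different censuses / machines). -/
theorem ExtremalFreeWindow.union {lo mid hi : ℝ} (h₁ : ExtremalFreeWindow lo mid)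
    (h₂ : ExtremalFreeWindow mid hi) : ExtremalFreeWindow lo hi := by
  intro c hc hlo hhi
  by_cases hm : intruderDist c ≤ mid
  · exact h₁ c hc hlo hm
  · exact h₂ c hc (le_of_lt (not_le.1 hm)) hhi

/-- The empty window (`hi < lo`) is cleared. -/
theorem extremalFreeWindow_of_lt {lo hi : ℝ} (h : hi < lo) : ExtremalFreeWindow lo hi :=
  fun _c _hc h1 h2 => absurd (h1.trans h2) (not_le.2 h)

/-- A gap already known up to `h` clears every window strictly below `h`: if `GapTupleDiam h`
(all admissible configurations have intruder distance `≥ h`) then `[lo, hi]` is cleared for every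
`hi < h`. (So a CUT clears the part of the range below it; the census is only needed above.) -/
theorem extremalFreeWindow_of_gapTupleDiam {h lo hi : ℝ} (hg : GapTupleDiam h) (hhi : hi < h) :
    ExtremalFreeWindow lo hi :=
  fun c hc _h1 h2 =>
    absurd (((gapTupleDiam_iff_forall_isGapConfig h).1 hg c hc.1.1).trans h2) (not_le.2 hhi)

/-! ## From a hole to a reduced extremal configuration in the window -/

/-- **A cut in the angular currency bounds every intruder distance from below**: `NoHole t₁`
(every shell has SOME direction within angle `< arccos t₁` of any `p`) gives
`2 t₁ ≤ intruderDist c` for every admissible configuration `c` (through `gapTupleDiam_of_noHole`).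
-/
theorem le_intruderDist_of_noHole {t₁ : ℝ} (h₁ : NoHole t₁) (c : Fin 14 → EuclideanSpace ℝ (Fin 3))
    (hc : IsGapConfig c) : 2 * t₁ ≤ intruderDist c := by
  have hg : GapTupleDiam (2 * t₁) :=
    gapTupleDiam_of_noHole (by rw [show 2 * t₁ / 2 = t₁ by ring]; exact h₁)
  exact (gapTupleDiam_iff_forall_isGapConfig _).1 hg c hc

/-- **If (AG) fails at level `t`, a reduced extremal configuration intrudes within `max (2t) 1`.**
A hole `(x, p)` at cosine level `t` is a fourteen-ball configuration with intruder distance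
`max (2t) 1` (`Bulk/HoleForm.lean`), so GAP fails at every `h > max (2t) 1`; reduced extremal
configurations exist (`exists_isReducedExtremal`, compactness + well-ordering) and all extremal
configurations share one intruder distance, which is therefore `≤ max (2t) 1`. -/
theorem exists_isReducedExtremal_of_not_noHole {t : ℝ} (h : ¬ NoHole t) :
    ∃ c, IsReducedExtremal c ∧ intruderDist c ≤ max (2 * t) 1 := by
  have key : ∀ h', max (2 * t) 1 < h' → ∃ c, IsReducedExtremal c ∧ intruderDist c < h' := by
    intro h' hh'
    refine (not_gapTupleDiam_iff_exists_isReducedExtremal h').1 fun hg => h ?_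
    have h1 : 1 < h' := lt_of_le_of_lt (le_max_right _ _) hh'
    have ht : t < h' / 2 := by
      have := le_max_left (2 * t) 1
      linarith
    exact noHole_of_gapTupleDiam h1 hg ht
  obtain ⟨c, hc, -⟩ := key (max (2 * t) 1 + 1) (by linarith)
  refine ⟨c, hc, le_of_forall_gt_imp_ge_of_dense fun h' hh' => ?_⟩
  obtain ⟨c', hc', hlt⟩ := key h' hh'
  rw [hc.1.intruderDist_eq hc'.1]
  exact hlt.le

/-- The same with `1/2 ≤ t` (hole radius `≤ 60°`, the only case that occurs: `max (2t) 1 = 2t`). -/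
theorem exists_isReducedExtremal_of_not_noHole' {t : ℝ} (ht : 1 / 2 ≤ t) (h : ¬ NoHole t) :
    ∃ c, IsReducedExtremal c ∧ intruderDist c ≤ 2 * t := by
  obtain ⟨c, hc, hle⟩ := exists_isReducedExtremal_of_not_noHole h
  exact ⟨c, hc, hle.trans (max_le le_rfl (by linarith))⟩

/-! ## The glue: CUT + cleared WINDOW ⇒ GAP -/

/-- **CUT + WINDOW ⇒ (AG)**, census-free core. If every admissible configuration has intruder
distance `≥ lo` (the cut) and no reduced extremal configuration has intruder distance in
`[lo, 2t]` (the cleared window), then `NoHole t` (for `t ≥ 1/2`). -/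
theorem noHole_of_extremalFreeWindow {t lo : ℝ} (ht : 1 / 2 ≤ t)
    (hcut : ∀ c, IsGapConfig c → lo ≤ intruderDist c) (hwin : ExtremalFreeWindow lo (2 * t)) :
    NoHole t := by
  by_contra h
  obtain ⟨c, hc, hle⟩ := exists_isReducedExtremal_of_not_noHole' ht h
  exact hwin c hc (hcut c hc.1.1) hle

/-- **THE SPRINT'S DECOMPOSITION (angular currency).** A cut at cosine level `t₁` — `NoHole t₁`,
i.e. `ρ* < arccos t₁` — together with the cleared window `[2t₁, 2t]` of intruder distances (hole
radii `ρ* ∈ [arccos t, arccos t₁]`, the census's tier) gives `NoHole t`. At `t = 0.63`: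
`TARGET-GAP.md` §4.2 (`t₁ = cos ρ_hi`, cut modulo `musinTarasov2012_tammes_thirteen`), §4.2′/(U)
(`t₁ = cos ρ_cut`, cut by a certified top cut), or `t₁ = 1/2` (cut = the kissing theorem,
`noHole_half`). -/
theorem noHole_of_noHole_of_extremalFreeWindow {t t₁ : ℝ} (ht : 1 / 2 ≤ t) (h₁ : NoHole t₁)
    (hwin : ExtremalFreeWindow (2 * t₁) (2 * t)) : NoHole t :=
  noHole_of_extremalFreeWindow ht (le_intruderDist_of_noHole h₁) hwin

/-- **CUT + WINDOW ⇒ GAP, fourteen-ball currency**: `GapTupleDiam lo` and a cleared window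
`[lo, hi]` give `GapTupleDiam hi`. -/
theorem gapTupleDiam_of_gapTupleDiam_of_extremalFreeWindow {lo hi : ℝ} (hg : GapTupleDiam lo)
    (hwin : ExtremalFreeWindow lo hi) : GapTupleDiam hi := by
  by_contra hng
  obtain ⟨c, hc, hlt⟩ := (not_gapTupleDiam_iff_exists_isReducedExtremal hi).1 hng
  exact hwin c hc ((gapTupleDiam_iff_forall_isGapConfig lo).1 hg c hc.1.1) hlt.le

/-! ## The cut at `60°` is a theorem: the kissing number -/

/-- **`NoHole (1/2)` holds outright**: a hole of angular radius `≥ 60°` in a shell of twelve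
`60°`-separated directions would make thirteen unit vectors pairwise at distance `≥ 1`, contradicting
the tree's PROVED kissing theorem `musin2006_kissing_three_holds` (`k(3) = 12`). So the window a
census must clear for the label UNCONDITIONAL is at most `[1, 1.26]` in intruder distances, i.e.
hole radii `[50.949877°, 60°]` (`TARGET-GAP.md` §4.2′, `I₁`). -/
theorem noHole_half : NoHole (1 / 2) := by
  intro x p hx hp hxx
  by_contra hall
  push Not at hall
  -- thirteen unit vectors pairwise at distance ≥ 1
  have hxinj : Function.Injective x := by
    intro i j hij
    by_contra hne
    have h := hxx i j hne
    rw [hij, real_inner_self_eq_norm_sq, hx j] at h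
    norm_num at h
  have hpx : ∀ i, p ≠ x i := by
    intro i hpi
    have h := hall i
    rw [hpi, real_inner_self_eq_norm_sq, hx i] at h
    norm_num at h
  set T : Finset (EuclideanSpace ℝ (Fin 3)) := insert p (univ.image x) with hT
  have hcard : T.card = 13 := by
    rw [hT, card_insert_of_notMem, card_image_of_injective _ hxinj, card_univ, Fintype.card_fin]
    intro hmem
    obtain ⟨i, -, hi⟩ := mem_image.1 hmem
    exact hpx i hi.symm
  have hunit : ∀ v ∈ T, ‖v‖ = 1 := by
    intro v hv
    rw [hT] at hv
    rcases mem_insert.1 hv with hv | hv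
    · rw [hv]; exact hp
    · obtain ⟨i, -, hi⟩ := mem_image.1 hv
      rw [← hi]; exact hx i
  have hpxd : ∀ i, (1 : ℝ) ≤ dist p (x i) := fun i =>
    (one_le_dist_iff_inner_le_half hp (hx i)).2 (hall i)
  have hsep : ∀ v ∈ T, ∀ w ∈ T, v ≠ w → (1 : ℝ) ≤ dist v w := by
    intro v hv w hw hvw
    rw [hT] at hv hw
    rcases mem_insert.1 hv with hv | hv
    · rcases mem_insert.1 hw with hw | hw
      · exact absurd (hv.trans hw.symm) hvw
      · obtain ⟨j, -, hj⟩ := mem_image.1 hw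
        rw [hv, ← hj]
        exact hpxd j
    · obtain ⟨i, -, hi⟩ := mem_image.1 hv
      rcases mem_insert.1 hw with hw | hw
      · rw [hw, ← hi, dist_comm]
        exact hpxd i
      · obtain ⟨j, -, hj⟩ := mem_image.1 hw
        have hij : i ≠ j := fun h => hvw (by rw [← hi, ← hj, h])
        rw [← hi, ← hj]
        exact (one_le_dist_iff_inner_le_half (hx i) (hx j)).2 (hxx i j hij)
  have h12 := musin2006_kissing_three_holds T hunit hsep
  omega

/-- Hence for the label UNCONDITIONAL the whole content of GAP(h) (`h ≤ 2t`, `t ≥ 1/2`) is a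
cleared window `[1, 2t]`: `ExtremalFreeWindow 1 (2t) → NoHole t`. -/
theorem noHole_of_extremalFreeWindow_one {t : ℝ} (ht : 1 / 2 ≤ t)
    (hwin : ExtremalFreeWindow 1 (2 * t)) : NoHole t :=
  noHole_of_noHole_of_extremalFreeWindow ht noHole_half (by rw [show (2 : ℝ) * (1 / 2) = 1 by ring]; exact hwin)

/-! ## The census form of a cleared window (named hypotheses) -/

namespace GapCensus

variable (S : GapCensus)

/-- **COMPLETENESS ON A WINDOW** (the PAPER side, theory seats — extremal reduction P-L1, local
structure P-L2, faces P-L3/L, and the inclusion of the admissible tight maps in the generator's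
class, on the tier `ρ ∈ [arccos (hi/2), arccos (lo/2)]`): every REDUCED EXTREMAL configuration
with intruder distance in the closed window `[lo, hi]` realises some cell of the universe. NAMED
HYPOTHESIS; `CompleteReduced h` of `Bulk/GapExtremal.lean` is the case `lo = -∞`, `hi ↑ h`. -/
def CompleteReducedOn (lo hi : ℝ) : Prop :=
  ∀ c, IsReducedExtremal c → lo ≤ intruderDist c → intruderDist c ≤ hi →
    ∃ cell ∈ S.univ, S.Realizes cell c

/-- Completeness on a window is inherited by sub-windows. -/
theorem CompleteReducedOn.mono {S : GapCensus} {lo hi lo' hi' : ℝ} (hC : S.CompleteReducedOn lo hi)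
    (hlo : lo ≤ lo') (hhi : hi' ≤ hi) : S.CompleteReducedOn lo' hi' :=
  fun c hc h1 h2 => hC c hc (hlo.trans h1) (h2.trans hhi)

/-- Completeness below `h` (`CompleteReduced h`) gives completeness on every closed window with top
`< h`. -/
theorem CompleteReduced.completeReducedOn {S : GapCensus} {h lo hi : ℝ} (hC : S.CompleteReduced h)
    (hhi : hi < h) : S.CompleteReducedOn lo hi :=
  fun c hc _h1 h2 => hC c hc (h2.trans_lt hhi)

/-- **A census complete on a window and fully killed clears the window.** -/
theorem extremalFreeWindow {lo hi : ℝ} (hC : S.CompleteReducedOn lo hi) (hK : S.AllKilled) :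
    ExtremalFreeWindow lo hi := by
  intro c hc h1 h2
  obtain ⟨cell, hcell, hreal⟩ := hC c hc h1 h2
  exact hK cell hcell c hc.1.1 hreal

/-- **Census glue, angular currency**: a cut `NoHole t₁` and a census complete on
`[2t₁, 2t]` and fully killed give `NoHole t` (`t ≥ 1/2`). -/
theorem noHole_of_noHole_of_census {t t₁ : ℝ} (ht : 1 / 2 ≤ t) (h₁ : NoHole t₁)
    (hC : S.CompleteReducedOn (2 * t₁) (2 * t)) (hK : S.AllKilled) : NoHole t :=
  noHole_of_noHole_of_extremalFreeWindow ht h₁ (S.extremalFreeWindow hC hK)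

/-- **Census glue, fourteen-ball currency**: `GapTupleDiam lo`, completeness on `[lo, hi]` and all
cells killed give `GapTupleDiam hi`. -/
theorem gapTupleDiam_of_gapTupleDiam_of_census {lo hi : ℝ} (hg : GapTupleDiam lo)
    (hC : S.CompleteReducedOn lo hi) (hK : S.AllKilled) : GapTupleDiam hi :=
  gapTupleDiam_of_gapTupleDiam_of_extremalFreeWindow hg (S.extremalFreeWindow hC hK)

end GapCensus

/-! ## Instances at the sprint's numbers (`t = 0.63`, GAP(1.26)) -/

/-- **GAP(1.26) from a cut and a cleared window**: `NoHole t₁` (`ρ* < arccos t₁`) and the cleared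
window `[2t₁, 1.26]` (hole radii `[50.949877°, arccos t₁]` — the census's tier) give `NoHole 0.63`.
-/
theorem noHole_063_of_noHole_of_window {t₁ : ℝ} (h₁ : NoHole t₁)
    (hwin : ExtremalFreeWindow (2 * t₁) 1.26) : NoHole 0.63 :=
  noHole_of_noHole_of_extremalFreeWindow (by norm_num) h₁
    (by rw [show (2 : ℝ) * 0.63 = 1.26 by norm_num]; exact hwin)

/-- **GAP(1.26), unconditional shape**: the cleared window `[1, 1.26]` (hole radii
`[50.949877°, 60°]`, the cut at `60°` being the proved kissing theorem) gives `NoHole 0.63`. -/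
theorem noHole_063_of_window_one (hwin : ExtremalFreeWindow 1 1.26) : NoHole 0.63 :=
  noHole_of_extremalFreeWindow_one (by norm_num)
    (by rw [show (2 : ℝ) * 0.63 = 1.26 by norm_num]; exact hwin)

/-- **GAP(1.26) from a cut and a census on the tier** (named hypotheses `CompleteReducedOn`,
`AllKilled`): `NoHole t₁ → S.CompleteReducedOn (2t₁) 1.26 → S.AllKilled → NoHole 0.63`. -/
theorem noHole_063_of_noHole_of_census (S : GapCensus) {t₁ : ℝ} (h₁ : NoHole t₁)
    (hC : S.CompleteReducedOn (2 * t₁) 1.26) (hK : S.AllKilled) : NoHole 0.63 :=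
  noHole_063_of_noHole_of_window h₁ (S.extremalFreeWindow hC hK)

/-- **… and bulk crystallization with `K = 1296`** given the classification of kissing
configurations at gap `2.52` (`Hales2012_kissingConfigCongruent`, the tree's computational theorem
`Hales2012_kissingConfigCongruent_holds`; a hypothesis here, standard axioms). -/
theorem bulkCrystallization3D_of_noHole_of_window_of_classification {t₁ : ℝ} (h₁ : NoHole t₁)
    (hwin : ExtremalFreeWindow (2 * t₁) 1.26) (hcl : Hales2012_kissingConfigCongruent) :
    BulkCrystallization3D 1296 :=
  bulkCrystallization3D_of_noHole_of_classification (noHole_063_of_noHole_of_window h₁ hwin) hcl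

/-- **… with the sharper constant `K = 702`** (`Bulk/GapReductionSharp.lean`), the classification
again a hypothesis (`KissingClassification 2.52 ↔ Hales2012_kissingConfigCongruent` by
`kissingClassification_two_mul_hales_h0_iff` and `two_mul_hales_h0`). -/
theorem bulkCrystallization3D_sharp_of_noHole_of_window_of_classification {t₁ : ℝ} (h₁ : NoHole t₁)
    (hwin : ExtremalFreeWindow (2 * t₁) 1.26) (hcl : Hales2012_kissingConfigCongruent) :
    BulkCrystallization3D 702 := by
  have hg : GapTupleDiam 1.26 := by
    have := gapTupleDiam_of_noHole (h := 1.26)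
      (by rw [show (1.26 : ℝ) / 2 = 0.63 by norm_num]; exact noHole_063_of_noHole_of_window h₁ hwin)
    exact this
  have hcl' : KissingClassification (2 * 1.26) := by
    rw [show (2 : ℝ) * 1.26 = 2 * hales_h0 by rw [two_mul_hales_h0]; norm_num]
    exact kissingClassification_two_mul_hales_h0_iff.2 hcl
  exact bulkCrystallization3D_sharp_of_gapTupleDiam_of_classification hg hcl'

end Summit.Ventures.Crystal3D

end
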